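import Mathlib
import HarnessLib
import Summits.ResolutionOfSingularities.ResolutionOfSingularities.Theorems.WildQuotientsWildQuotientResolutionZ9PeeledI28Stable
import Summits.ResolutionOfSingularities.ResolutionOfSingularities.Theorems.WildQuotientsWildQuotientResolutionZ9PeeledConjCharts

/-!
# ℤ9 SPECIMEN (peeled `𝔸⁴/ℤ9`, char 3): the stable pieces `P_T`, `P₂` as single Rees charts
# `P_T = D₊(N₁⁷ t³)`, `P₂ = D₊(N₂²⁸ t³)` of INVARIANT norm monomials
(crux stmt-ResolutionOfSingularities-15640 `WildQuotients.WildQuotientResolution`, line `Sketch`; S1 =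
stmt-ResolutionOfSingularities-17941 `CyclicQuotientFourfolds`; chain w45c card P specimen «peeled 𝔸⁴/ℤ9» —
res-L1-w45c-idea-2 `cardP_g12/Z9-SPECIMEN.md` §2 / `Z4T-TWIST.md` §1, res-L1-w45c-plan-1 REQUEST 2026-08-27T17:34:34Z
(a) «the single-basic-open identities `P_T = D₊(N₁⁷t³)` (stub-2's Z4T seam) and `P₂ = D₊(N₂²⁸t³)` (stub-3's Z5) in
a small `…Z9PeeledPieceMonomials.lean`»; pieces of record = `…Z9PeeledStableCover` (⨅-form is the DEFINITION,
these are LEMMAS). [OURS · L1 W4.5c] — NOT a statement of any manuscript; replaces the role of no printed item;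
AI-produced, weaker than expert review. Def-free. Prover res-D-pv-033.)

Letters of record: abstract `g : Fin 24 → k[x]` with the exponent table `hg`; `σ` with `h0 : σ (X a) = X a`,
`hb : σ (X b) = X b + X a`, `hc : σ (X c) = X c + X b`; `ρ hρ` affine-quotient law, `hJ` ABSTRACT,
`L γ := ((affineBlowup.isBlowup I).liftAction ρ hJ) γ`, `D₊ j := Proj.basicOpen (reesGrading I) (g j · t)`,
`I = Ideal.span (Set.range g)`. For a generator `g j` whose `σ`-orbit has length `3` (`(σ^3) (g j) = g j`; for
`j = 16, 23` this is characteristic `3`: `σ³ x_b = x_b + 3x_a`, `σ³ x_c = x_c + 3x_b + 3x_a`) the ORBIT NORM ELEMENT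
`normT j := (g j · t)·(σ(g j) · t)·(σ²(g j) · t) ∈ k[x][I t]₃` is the Rees MONOMIAL `(g j · σ(g j) · σ²(g j)) t³` and:
* `smul_eq_or_of_pow_three` — every `γ ∈ ⟨σ⟩` moves `g j` to `g j`, `σ (g j)` or `σ² (g j)`;
* **`piece_eq_basicOpen_normT`** — `⨅ γ, (L γ)⁻¹ D₊ j = D₊(normT j)` (transport
  `BlowupExit.preimage_basicOpen_reesT_liftAction` + the orbit lemma + `Proj.basicOpen_mul`);
* `coe_normT` — `(normT j : k[x][t]) = monomial 3 (g j · σ(g j) · σ²(g j))`; `smul_norm_eq` — the radicand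
  `g j · σ(g j) · σ²(g j)` is `⟨σ⟩`-INVARIANT (so `ToricExit.preimage_basicOpen_liftAction_of_monomial` and the seam
  `BlowupExit.exists_basicOpen_sectionsEquiv` apply to `D₊(normT j)` verbatim);
* the radicands in closed form: `norm_g16_eq` — `x_b⁷ (x_b+x_a)⁷ (x_b+2x_a)⁷ = (x_b (x_b+x_a)(x_b+2x_a))⁷ = N₁⁷`,
  in characteristic `3` `= (x_b³ − x_a² x_b)⁷` (`norm_g16_eq_char3`, idea-2's `N₁`); `norm_g23_eq` —
  `(x_c (x_c+x_b)(x_c+2x_b+x_a))²⁸ = N₂²⁸`, in characteristic `3` with `x_c + 2x_b + x_a = x_c − x_b + x_a`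
  (`norm_g23_eq_char3`); and `pow_three_g16/_g23` (`σ³` fixes `g 16`, `g 23` in characteristic `3`).
-/

-- single-problem summit: the doubled namespace component `ResolutionOfSingularities` is forced
set_option linter.dupNamespace false

noncomputable section

open CategoryTheory AlgebraicGeometry TopologicalSpace MvPolynomial Polynomial
open scoped Pointwise
open Literature.AlgebraicGeometry.Resolution

namespace Summit.ResolutionOfSingularities.ResolutionOfSingularities.Theorems.WildQuotientResolution.Z9Peeled

variable (k : Type) [Field k] (n : ℕ) (a b c : Fin n)

/-- The exponent table of the 24 generators of `I₂₈` (memo §1 order; local shorthand used only inside theorem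
signatures). -/
local notation3 "e24" => (![(4, 0, 0), (3, 2, 0), (3, 1, 3), (3, 0, 7), (2, 4, 0), (2, 3, 2), (2, 2, 6), (2, 1, 10), (2, 0, 14), (1, 6, 0), (1, 5, 1), (1, 4, 5), (1, 3, 9), (1, 2, 13), (1, 1, 17), (1, 0, 21), (0, 7, 0), (0, 6, 4), (0, 5, 8), (0, 4, 12), (0, 3, 16), (0, 2, 20), (0, 1, 24), (0, 0, 28)] : Fin 24 → ℕ × ℕ × ℕ)

section Orbit

variable (σ : MvPolynomial (Fin n) k ≃ₐ[k] MvPolynomial (Fin n) k)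

/-- **Orbits of length three**: if `σ³ x = x` then every `γ ∈ ⟨σ⟩` moves `x` to `x`, `σ x` or `σ (σ x)`.
[folklore] -/
theorem smul_eq_or_of_pow_three (x : MvPolynomial (Fin n) k) (h3 : (σ ^ 3) x = x)
    (γ : Subgroup.zpowers σ) :
    γ • x = x ∨ γ • x = σ x ∨ γ • x = σ (σ x) := by
  obtain ⟨z, hz⟩ := Subgroup.mem_zpowers_iff.mp γ.2
  have h3' : (σ ^ (3 : ℤ)) • x = x := by
    rw [show ((3 : ℤ)) = ((3 : ℕ) : ℤ) from rfl, zpow_natCast]; exact h3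
  have hfix : ((σ ^ (3 : ℤ)) ^ (z / 3)) • x = x :=
    MulAction.fixedBy_subset_fixedBy_zpow (MvPolynomial (Fin n) k) (σ ^ (3 : ℤ)) (z / 3) h3'
  change (γ : MvPolynomial (Fin n) k ≃ₐ[k] MvPolynomial (Fin n) k) • x = x ∨
    (γ : MvPolynomial (Fin n) k ≃ₐ[k] MvPolynomial (Fin n) k) • x = σ x ∨
    (γ : MvPolynomial (Fin n) k ≃ₐ[k] MvPolynomial (Fin n) k) • x = σ (σ x)
  rw [← hz]
  have hzeq : z = z % 3 + 3 * (z / 3) := by omega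
  rw [hzeq, zpow_add, zpow_mul, mul_smul, hfix]
  have hr0 : 0 ≤ z % 3 := Int.emod_nonneg _ (by norm_num)
  have hr3 : z % 3 < 3 := Int.emod_lt_of_pos _ (by norm_num)
  generalize z % 3 = r at hr0 hr3
  interval_cases r
  · left; simp
  · right; left; simp
  · right; right
    rw [show (2 : ℤ) = ((2 : ℕ) : ℤ) from rfl, zpow_natCast, pow_two]
    rfl

end Orbit

section Norms

variable (σ : MvPolynomial (Fin n) k ≃ₐ[k] MvPolynomial (Fin n) k)
  (h0 : σ (X a) = X a) (hb : σ (X b) = X b + X a) (hc : σ (X c) = X c + X b)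

include h0 hb in
/-- `σ³` fixes `g 16 = x_b⁷` in characteristic `3`. [folklore] -/
theorem pow_three_g16 [CharP (MvPolynomial (Fin n) k) 3] (g : Fin 24 → MvPolynomial (Fin n) k)
    (hg : ∀ q, g q = X a ^ (e24 q).1 * X b ^ (e24 q).2.1 * X c ^ (e24 q).2.2) : (σ ^ 3) (g 16) = g 16 := by
  have hg16 : g 16 = X a ^ 0 * X b ^ 7 * X c ^ 0 := hg 16
  have h1 : (σ ^ 3) (X b) = X b + 3 * X a := by
    rw [pow_succ, pow_two, AlgEquiv.mul_apply, AlgEquiv.mul_apply, hb, map_add, hb, h0, map_add, map_add,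
      hb, h0]
    ring
  have h3 : (3 : MvPolynomial (Fin n) k) = 0 := by exact_mod_cast CharP.cast_eq_zero (MvPolynomial (Fin n) k) 3
  rw [hg16, pow_zero, pow_zero, one_mul, mul_one, map_pow, h1, h3, zero_mul, add_zero]

include h0 hb hc in
/-- `σ³` fixes `g 23 = x_c²⁸` in characteristic `3`. [folklore] -/
theorem pow_three_g23 [CharP (MvPolynomial (Fin n) k) 3] (g : Fin 24 → MvPolynomial (Fin n) k)
    (hg : ∀ q, g q = X a ^ (e24 q).1 * X b ^ (e24 q).2.1 * X c ^ (e24 q).2.2) : (σ ^ 3) (g 23) = g 23 := by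
  have hg23 : g 23 = X a ^ 0 * X b ^ 0 * X c ^ 28 := hg 23
  have h1 : (σ ^ 3) (X c) = X c + 3 * X b + 3 * X a := by
    rw [pow_succ, pow_two, AlgEquiv.mul_apply, AlgEquiv.mul_apply, hc, map_add, hc, hb, map_add, map_add,
      map_add, hc, hb, h0]
    ring
  have h3 : (3 : MvPolynomial (Fin n) k) = 0 := by exact_mod_cast CharP.cast_eq_zero (MvPolynomial (Fin n) k) 3
  rw [hg23, pow_zero, pow_zero, one_mul, one_mul, map_pow, h1, h3, zero_mul, zero_mul, add_zero, add_zero]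

include h0 hb in
/-- The orbit product of `g 16 = x_b⁷`: `x_b⁷ (x_b+x_a)⁷ (x_b+2x_a)⁷ = (x_b (x_b+x_a)(x_b+2x_a))⁷` (any characteristic).
[folklore] -/
theorem norm_g16_eq (g : Fin 24 → MvPolynomial (Fin n) k)
    (hg : ∀ q, g q = X a ^ (e24 q).1 * X b ^ (e24 q).2.1 * X c ^ (e24 q).2.2) :
    g 16 * σ (g 16) * σ (σ (g 16)) = (X b * (X b + X a) * (X b + 2 * X a)) ^ 7 := by
  have hg16 : g 16 = X a ^ 0 * X b ^ 7 * X c ^ 0 := hg 16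
  rw [hg16, pow_zero, pow_zero, one_mul, mul_one, map_pow, hb, map_pow, map_add, hb, h0, ← mul_pow, ← mul_pow]
  congr 1
  ring

include h0 hb in
/-- Characteristic `3`: the orbit product of `x_b⁷` is `N₁⁷`, `N₁ = x_b³ − x_a² x_b = x_b (x_b+x_a)(x_b−x_a)`
(idea-2's `Z4T-TWIST.md`). [folklore] -/
theorem norm_g16_eq_char3 [CharP (MvPolynomial (Fin n) k) 3] (g : Fin 24 → MvPolynomial (Fin n) k)
    (hg : ∀ q, g q = X a ^ (e24 q).1 * X b ^ (e24 q).2.1 * X c ^ (e24 q).2.2) :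
    g 16 * σ (g 16) * σ (σ (g 16)) = (X b ^ 3 - X a ^ 2 * X b) ^ 7 := by
  have h3 : (3 : MvPolynomial (Fin n) k) = 0 := by exact_mod_cast CharP.cast_eq_zero (MvPolynomial (Fin n) k) 3
  rw [norm_g16_eq k n a b c σ h0 hb g hg]
  have e : (X b * (X b + X a) * (X b + 2 * X a) : MvPolynomial (Fin n) k) =
      X b ^ 3 - X a ^ 2 * X b + 3 * (X a * X b ^ 2 + X a ^ 2 * X b) := by ring
  rw [e, h3, zero_mul, add_zero]

include hb hc in
/-- The orbit product of `g 23 = x_c²⁸`: `(x_c (x_c+x_b)(x_c+2x_b+x_a))²⁸` (any characteristic). [folklore] -/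
theorem norm_g23_eq (g : Fin 24 → MvPolynomial (Fin n) k)
    (hg : ∀ q, g q = X a ^ (e24 q).1 * X b ^ (e24 q).2.1 * X c ^ (e24 q).2.2) :
    g 23 * σ (g 23) * σ (σ (g 23)) = (X c * (X c + X b) * (X c + 2 * X b + X a)) ^ 28 := by
  have hg23 : g 23 = X a ^ 0 * X b ^ 0 * X c ^ 28 := hg 23
  rw [hg23, pow_zero, pow_zero, one_mul, one_mul, map_pow, hc, map_pow, map_add, hc, hb, ← mul_pow, ← mul_pow]
  congr 1
  ring

include hb hc in
/-- Characteristic `3`: the orbit product of `x_c²⁸` is `N₂²⁸`, `N₂ = x_c (x_c+x_b)(x_c−x_b+x_a)`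
(`= x_c·σ̄x_c·σ̄²x_c`). [folklore] -/
theorem norm_g23_eq_char3 [CharP (MvPolynomial (Fin n) k) 3] (g : Fin 24 → MvPolynomial (Fin n) k)
    (hg : ∀ q, g q = X a ^ (e24 q).1 * X b ^ (e24 q).2.1 * X c ^ (e24 q).2.2) :
    g 23 * σ (g 23) * σ (σ (g 23)) = (X c * (X c + X b) * (X c - X b + X a)) ^ 28 := by
  have h3 : (3 : MvPolynomial (Fin n) k) = 0 := by exact_mod_cast CharP.cast_eq_zero (MvPolynomial (Fin n) k) 3
  rw [norm_g23_eq k n a b c σ hb hc g hg]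
  have e : (X c + 2 * X b + X a : MvPolynomial (Fin n) k) = (X c - X b + X a) + 3 * X b := by ring
  rw [e, h3, zero_mul, add_zero]

/-- **The radicand of an orbit of length three is invariant**: if `σ³ x = x` then
`γ • (x · σx · σ²x) = x · σx · σ²x` for every `γ ∈ ⟨σ⟩`. [folklore] -/
theorem smul_norm_eq (x : MvPolynomial (Fin n) k) (h3 : (σ ^ 3) x = x) (γ : Subgroup.zpowers σ) :
    γ • (x * σ x * σ (σ x)) = x * σ x * σ (σ x) := by
  have hσx : σ (σ (σ x)) = x := by
    have h := h3; rwa [pow_succ, pow_two, AlgEquiv.mul_apply, AlgEquiv.mul_apply] at h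
  -- `γ` commutes with `σ`
  have hcomm : ∀ y, γ • σ y = σ (γ • y) := by
    intro y
    obtain ⟨z, hz⟩ := Subgroup.mem_zpowers_iff.mp γ.2
    change (γ : MvPolynomial (Fin n) k ≃ₐ[k] MvPolynomial (Fin n) k) (σ y) =
      σ ((γ : MvPolynomial (Fin n) k ≃ₐ[k] MvPolynomial (Fin n) k) y)
    rw [← hz, ← AlgEquiv.mul_apply, ← AlgEquiv.mul_apply, ← zpow_add_one, ← zpow_one_add, add_comm]
  rw [smul_mul', smul_mul', hcomm, hcomm, hcomm]
  rcases smul_eq_or_of_pow_three k n σ x h3 γ with h | h | h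
  · rw [h]
  · rw [h, hσx]; ring
  · rw [h]; simp only [hσx]; ring

end Norms

section Pieces

variable (g : Fin 24 → MvPolynomial (Fin n) k) (σ : MvPolynomial (Fin n) k ≃ₐ[k] MvPolynomial (Fin n) k)
  (h0 : σ (X a) = X a) (hb : σ (X b) = X b + X a) (hc : σ (X c) = X c + X b)

/-- the Rees generator `g_j t` -/
local notation3 (prettyPrint := false) "gT" j =>
  reesT (I := Ideal.span (Set.range g)) (g j) (Ideal.mem_span_range_self (f := g) (x := j))
/-- the vertex chart `D₊(g_j t)` -/
local notation3 (prettyPrint := false) "D₊" j =>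
  Proj.basicOpen (reesGrading (Ideal.span (Set.range g))) (gT j)

include h0 hb hc in
/-- `σ (g j) ∈ I₂₈` (from `σ(I₂₈) = I₂₈`, `…Z9PeeledI28Stable`). [folklore] -/
theorem sigma_apply_mem (hg : ∀ q, g q = X a ^ (e24 q).1 * X b ^ (e24 q).2.1 * X c ^ (e24 q).2.2)
    (x : MvPolynomial (Fin n) k) (hx : x ∈ Ideal.span (Set.range g)) : σ x ∈ Ideal.span (Set.range g) := by
  have h := Ideal.mem_map_of_mem (σ : MvPolynomial (Fin n) k →+* MvPolynomial (Fin n) k) hx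
  rw [map_I28_eq k n a b c σ h0 hb hc g hg] at h
  exact h

include h0 hb hc in
/-- The orbit norm element `normT j = (g j t)(σ(g j) t)(σ²(g j) t)` has degree `3` (stated as `1 + 1 + 1`, the form
`SetLike.mul_mem_graded` produces; use `(by norm_num : 0 < 1 + 1 + 1)` for affineness). [folklore] -/
theorem normT_mem (hg : ∀ q, g q = X a ^ (e24 q).1 * X b ^ (e24 q).2.1 * X c ^ (e24 q).2.2) (j : Fin 24) :
    (gT j) * reesT (σ (g j)) (sigma_apply_mem k n a b c g σ h0 hb hc hg _ (Ideal.mem_span_range_self)) *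
        reesT (σ (σ (g j))) (sigma_apply_mem k n a b c g σ h0 hb hc hg _
          (sigma_apply_mem k n a b c g σ h0 hb hc hg _ (Ideal.mem_span_range_self))) ∈
      reesGrading (Ideal.span (Set.range g)) (1 + 1 + 1) :=
  SetLike.mul_mem_graded (SetLike.mul_mem_graded (reesT_mem _ _) (reesT_mem _ _)) (reesT_mem _ _)

include h0 hb hc in
/-- **`normT j` is the Rees MONOMIAL `(g j · σ(g j) · σ²(g j)) t³`.** [folklore] -/
theorem coe_normT (hg : ∀ q, g q = X a ^ (e24 q).1 * X b ^ (e24 q).2.1 * X c ^ (e24 q).2.2) (j : Fin 24) :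
    (((gT j) * reesT (σ (g j)) (sigma_apply_mem k n a b c g σ h0 hb hc hg _ (Ideal.mem_span_range_self)) *
        reesT (σ (σ (g j))) (sigma_apply_mem k n a b c g σ h0 hb hc hg _
          (sigma_apply_mem k n a b c g σ h0 hb hc hg _ (Ideal.mem_span_range_self))) :
        reesAlgebra (Ideal.span (Set.range g))) : (MvPolynomial (Fin n) k)[X]) =
      monomial 3 (g j * σ (g j) * σ (σ (g j))) := by
  simp only [Subalgebra.coe_mul, coe_reesT, Polynomial.monomial_mul_monomial]

include h0 hb hc in
/-- **`P_j = D₊(normT j)`**: for a generator with `σ³ (g j) = g j`, the orbit intersection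
`⨅ γ, (L γ)⁻¹ D₊(g j · t)` of the Rees chart `D₊(g j · t)` is the single Rees chart of the orbit norm element
(`j = 16`: `P_T = D₊(N₁⁷t³)`; `j = 23`: `P₂ = D₊(N₂²⁸t³)`, by `norm_g16_eq_char3` / `norm_g23_eq_char3`).
[OURS · L1 W4.5c] [folklore] -/
theorem piece_eq_basicOpen_normT (hg : ∀ q, g q = X a ^ (e24 q).1 * X b ^ (e24 q).2.1 * X c ^ (e24 q).2.2)
    (j : Fin 24) (h3 : (σ ^ 3) (g j) = g j)
    (ρ : ↥(Subgroup.zpowers σ) →* Aut (Spec (CommRingCat.of (MvPolynomial (Fin n) k))))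
    (hρ : ∀ γ : ↥(Subgroup.zpowers σ), (ρ γ).hom = Spec.map (CommRingCat.ofHom
      ((MulSemiringAction.toRingEquiv (↥(Subgroup.zpowers σ)) (MvPolynomial (Fin n) k) γ⁻¹ :
        MvPolynomial (Fin n) k ≃+* MvPolynomial (Fin n) k) :
          MvPolynomial (Fin n) k →+* MvPolynomial (Fin n) k)))
    (hJ : ∀ γ : ↥(Subgroup.zpowers σ),
      (affineBlowup.idealSheaf (Ideal.span (Set.range g))).comap (ρ γ).hom =
        affineBlowup.idealSheaf (Ideal.span (Set.range g))) :
    (⨅ γ : ↥(Subgroup.zpowers σ),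
        (((affineBlowup.isBlowup (Ideal.span (Set.range g))).liftAction ρ hJ) γ).hom ⁻¹ᵁ (D₊ j)) =
      Proj.basicOpen (reesGrading (Ideal.span (Set.range g)))
        ((gT j) * reesT (σ (g j)) (sigma_apply_mem k n a b c g σ h0 hb hc hg _ (Ideal.mem_span_range_self)) *
          reesT (σ (σ (g j))) (sigma_apply_mem k n a b c g σ h0 hb hc hg _
            (sigma_apply_mem k n a b c g σ h0 hb hc hg _ (Ideal.mem_span_range_self)))) := by
  -- transport of the chart under each `γ`, with the right membership proof
  have hmemγ : ∀ γ : ↥(Subgroup.zpowers σ), γ⁻¹ • g j ∈ Ideal.span (Set.range g) := by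
    intro γ
    rcases smul_eq_or_of_pow_three k n σ (g j) h3 γ⁻¹ with h | h | h <;> rw [h]
    · exact Ideal.mem_span_range_self
    · exact sigma_apply_mem k n a b c g σ h0 hb hc hg _ Ideal.mem_span_range_self
    · exact sigma_apply_mem k n a b c g σ h0 hb hc hg _
        (sigma_apply_mem k n a b c g σ h0 hb hc hg _ Ideal.mem_span_range_self)
  have htr : ∀ γ : ↥(Subgroup.zpowers σ),
      (((affineBlowup.isBlowup (Ideal.span (Set.range g))).liftAction ρ hJ) γ).hom ⁻¹ᵁ (D₊ j) =
        Proj.basicOpen (reesGrading (Ideal.span (Set.range g))) (reesT (γ⁻¹ • g j) (hmemγ γ)) :=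
    fun γ => BlowupExit.preimage_basicOpen_reesT_liftAction ρ hρ hJ _ γ (hmemγ γ)
  -- equality of Rees charts along an equality of generators
  have key : ∀ (u v : MvPolynomial (Fin n) k) (hu : u ∈ Ideal.span (Set.range g))
      (hv : v ∈ Ideal.span (Set.range g)), u = v →
      Proj.basicOpen (reesGrading (Ideal.span (Set.range g))) (reesT u hu) =
        Proj.basicOpen (reesGrading (Ideal.span (Set.range g))) (reesT v hv) := by
    rintro u v hu hv rfl; rfl
  rw [Proj.basicOpen_mul, Proj.basicOpen_mul]
  apply le_antisymm
  · -- `⨅ ≤`: the members `γ = 1`, `γ = σ⁻¹`, `γ = σ⁻²`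
    have hσmem : σ ∈ Subgroup.zpowers σ := Subgroup.mem_zpowers σ
    refine le_inf (le_inf ?_ ?_) ?_
    · refine (iInf_le _ (1 : ↥(Subgroup.zpowers σ))).trans (le_of_eq ?_)
      rw [htr]
      exact key _ _ _ _ (by rw [inv_one, one_smul])
    · refine (iInf_le _ (⟨σ, hσmem⟩⁻¹ : ↥(Subgroup.zpowers σ))).trans (le_of_eq ?_)
      rw [htr]
      exact key _ _ _ _ (by rw [inv_inv]; rfl)
    · refine (iInf_le _ ((⟨σ, hσmem⟩ * ⟨σ, hσmem⟩)⁻¹ : ↥(Subgroup.zpowers σ))).trans (le_of_eq ?_)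
      rw [htr]
      exact key _ _ _ _ (by rw [inv_inv, mul_smul]; rfl)
  · -- `≤ ⨅`: every transported chart is one of the three
    refine le_iInf fun γ => ?_
    rw [htr]
    rcases smul_eq_or_of_pow_three k n σ (g j) h3 γ⁻¹ with h | h | h
    · rw [key _ (g j) (hmemγ γ) Ideal.mem_span_range_self h]
      exact inf_le_left.trans inf_le_left
    · rw [key _ (σ (g j)) (hmemγ γ) (sigma_apply_mem k n a b c g σ h0 hb hc hg _ Ideal.mem_span_range_self) h]
      exact inf_le_left.trans inf_le_right
    · rw [key _ (σ (σ (g j))) (hmemγ γ) (sigma_apply_mem k n a b c g σ h0 hb hc hg _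
        (sigma_apply_mem k n a b c g σ h0 hb hc hg _ Ideal.mem_span_range_self)) h]
      exact inf_le_right

end Pieces

end Summit.ResolutionOfSingularities.ResolutionOfSingularities.Theorems.WildQuotientResolution.Z9Peeled

end
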